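import Literature.MathematicalPhysics.QuantumFieldTheory.ConformalBootstrap3D.PointKernelK34v2Data
import Literature.MathematicalPhysics.QuantumFieldTheory.ConformalBootstrap3D.PointKernelParts

/-!
# K34v2 certificate, kernel part file P44: one-cell head segments 152, 153 in level ranges

The head cells whose kernel evaluation exceeds one `decide` are one-cell segments of `hsegsK34v2`; each is
checked by `PCert.hPartSideOK` (side conditions) and `PCert.hPartOK` per level range `[n_lo, n_lo + count)`
against an integer claim, the claims summing to `≥ 0` (`PointKernel.partsOK`); soundness is
`PCert.hParts_sound` (`PointKernelParts`).  The part files `P1, P2, …` are mutually independent (each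
imports only the data file); the ranges of one cell may span several of them, and the per-cell
conclusions `hparts_i` / `hcell_i` of those cells are assembled in `PointKernelK34v2.lean`.
Estimated kernel time 242 s.
-/

set_option maxRecDepth 100000
set_option maxHeartbeats 0

namespace Literature.MathematicalPhysics.QuantumFieldTheory.ConformalBootstrap3D.PointKernelK34v2

open Literature.MathematicalPhysics.QuantumFieldTheory.ConformalBootstrap3D.PointKernel

/-- levels `[68, 71)` of segment 152: partial lower sum `≥` claim. [folklore] -/
theorem part_152_8 : certK34v2.hPartOK (PCert.segAt hsegsK34v2 152) JHK34v2 68 3 (125515113024576215239547991446420157) = true := by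
  decide +kernel

/-- levels `[71, 73)` of segment 152: partial lower sum `≥` claim. [folklore] -/
theorem part_152_9 : certK34v2.hPartOK (PCert.segAt hsegsK34v2 152) JHK34v2 71 2 (59562800261383354712299032332968809) = true := by
  decide +kernel

/-- one-cell segment 153 (row 6, cell `[3587/512, 7175/1024]`, chord, `n_F = 72`,
10 level ranges): side conditions. [folklore] -/
theorem pside_153 : certK34v2.hPartSideOK (PCert.segAt hsegsK34v2 153) JHK34v2 = true := by
  decide +kernel

/-- its level ranges `(n_lo, count, claim)`. [folklore] -/
def parts_153 : List (ℕ × ℕ × ℤ) := [(0, 25, -42423147491296000128598572030573774274), (25, 11, 27147912949716749769672509720821565272), (36, 8, 9027263194088569582556702620862884740), (44, 6, 3234956576708981975928550880653454385), (50, 5, 1456434636230031360484698968777102078), (55, 5, 821808598960180479714533898287933219), (60, 4, 377410682691391978221230469988888950), (64, 4, 228093819653031527480495117587326196), (68, 3, 97631203948793886676163926074838793), (71, 2, 31635829298269567863686427519780645)]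

/-- the ranges tile `[0, n_F]` and the claims sum to `≥ 0`. [folklore] -/
theorem pcov_153 : PointKernel.partsOK 72 parts_153 = true := by
  decide +kernel

/-- levels `[0, 25)` of segment 153: partial lower sum `≥` claim. [folklore] -/
theorem part_153_0 : certK34v2.hPartOK (PCert.segAt hsegsK34v2 153) JHK34v2 0 25 (-42423147491296000128598572030573774274) = true := by
  decide +kernel

/-- levels `[25, 36)` of segment 153: partial lower sum `≥` claim. [folklore] -/
theorem part_153_1 : certK34v2.hPartOK (PCert.segAt hsegsK34v2 153) JHK34v2 25 11 (27147912949716749769672509720821565272) = true := by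
  decide +kernel

end Literature.MathematicalPhysics.QuantumFieldTheory.ConformalBootstrap3D.PointKernelK34v2
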